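import Summits.RiemannHypothesis.RiemannHypothesis.Theorems.SoninCertBEnclose
import HarnessLib

/-!
# Sonin-space certificate at `b = 107/200`, P4-D: `B ≥ 51/10⁴` — the kernel enclosure contains the real `B`

Cell `rh-explicit`, seat cc-s2-3, Phase 2 (lead R7-12/R7-12a).  Last `B`-side file: the exponential moments
`J(q; a₁, a₂) = ∫ κ(u) e^{qu/2} du` over `u = b + b s`, `s ∈ [a₁, a₂] ⊆ [−1, 1]`, equal
`b e^{x} (Σ_{m<130} x^m/m! ∫_{a₁}^{a₂} s^m κ̂(s) ds + ρ)`, `x = q b/2`, `|ρ| ≤ (a₂ − a₁)·Â·2|x|^{130}/130!`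
(`Complex.exp_bound'`), hence lie in the kernel's `JI` (file P4-C for the main term, `MI.mem_widen` + `remZ` for `ρ`);
so `Comb(q/2) ∈ combI`, then `∈ combT` by the kernel theorems `combCheck_neg/pos`, so `Breal ∈ bsumI`, and
`checkB_eq_true` gives **`BloQ ≤ B = Re ⟨η | ϑ(T₂ k_G) η⟩`** (`BloQ_le_re_soninTraceForm`) — the hypothesis `hB` of
cc-s2-1's bridge `not_semilocalSoninIneqOn_two_of_bdd_witness_one`.  Proof-only file.  No facts, no axioms;
nothing about `ζ`.
-/

set_option linter.dupNamespace false  -- the mandated namespace repeats `RiemannHypothesis`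

noncomputable section

open MeasureTheory Set Finset
open Summit.RiemannHypothesis.RiemannHypothesis.Theorems.SemilocalPolyWitness
open Literature.Analysis.ValidatedNumerics Literature.Analysis.ValidatedNumerics.NumericsMP
open Literature.NumberTheory.ConnesConsani2021 Literature.NumberTheory.LFunctions

namespace Summit.RiemannHypothesis.RiemannHypothesis.SoninCert

/-! ## The engine constants -/

/-- The enclosures of `log 2`, `e^{107/400}`, `e^{−107/400}` produced by `constsOpt`. [folklore] -/
theorem consts_mem {c : MI × MI × MI} (h : constsOpt = some c) :
    MI.mem S4 (Real.log 2) c.1 ∧ MI.mem S4 (Real.exp (107 / 400)) c.2.1 ∧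
      MI.mem S4 (Real.exp (-(107 / 400))) c.2.2 := by
  unfold constsOpt at h
  split at h
  · rename_i a e e' ha he he'
    cases h
    have h1 : MI.mem S4 ((107 : ℝ) / 400) (MI.ofFrac S4 107 400) := by
      have := MI.mem_ofFrac S4 107 (q := 400) (by norm_num); norm_num at this; exact this
    have h2 : MI.mem S4 (-((107 : ℝ) / 400)) (MI.ofFrac S4 (-107) 400) := by
      have := MI.mem_ofFrac S4 (-107) (q := 400) (by norm_num); norm_num at this; exact this
    exact ⟨MI.mem_logTwo S4_pos ha, MI.mem_exp S4_pos he h1, MI.mem_exp S4_pos he' h2⟩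
  · exact absurd h (by simp)

/-- `constsOpt` succeeds (otherwise `combCheck` would be `false`). [folklore] -/
theorem constsOpt_isSome : ∃ c, constsOpt = some c := by
  have h := combCheck_neg
  unfold combCheck at h
  cases hc : constsOpt with
  | none => rw [hc] at h; exact absurd h (by simp)
  | some c => exact ⟨c, rfl⟩

/-! ## The literal table -/

/-- From a passed group check: members of `combI c q` are members of the table entry `combT q`. [folklore] -/
theorem mem_combT_of_check {c : MI × MI × MI} (hc : constsOpt = some c) {qs : List ℤ} (h : combCheck qs = true)
    {q : ℤ} (hq : q ∈ qs) {x : ℝ} (hx : MI.mem S4 x (combI c q)) : MI.mem S4 x (combT q) := by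
  unfold combCheck at h
  rw [hc] at h
  have h' := List.all_eq_true.1 h q hq
  simp only [subsetI, Bool.and_eq_true, decide_eq_true_eq] at h'
  rw [MI.mem_def] at hx ⊢
  exact ⟨(Int.cast_le.2 h'.1).trans hx.1, hx.2.trans (Int.cast_le.2 h'.2)⟩

/-! ## The exponential moments `J` -/

/-- Substitution `u = b + b s`: `∫_{b a₁ + b}^{b a₂ + b} κ(u) e^{qu/2} du = b e^{x} ∫_{a₁}^{a₂} κ̂(s) e^{x s} ds`,
`x = q·107/400`. [folklore] -/
theorem J_subst (q : ℤ) (a₁ a₂ : ℝ) :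
    ∫ u in ((bQ : ℝ) * a₁ + bQ)..((bQ : ℝ) * a₂ + bQ), LQ.ev kapLit u * expq q u
      = (bQ : ℝ) * Real.exp ((q : ℝ) * (107 / 400)) *
          ∫ s in a₁..a₂, LQ.ev khatQ s * Real.exp ((q : ℝ) * 107 / 400 * s) := by
  have h : (bQ : ℝ) • ∫ s in a₁..a₂, LQ.ev kapLit ((bQ : ℝ) * s + bQ) * expq q ((bQ : ℝ) * s + bQ)
      = ∫ u in ((bQ : ℝ) * a₁ + bQ)..((bQ : ℝ) * a₂ + bQ), LQ.ev kapLit u * expq q u :=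
    intervalIntegral.smul_integral_comp_mul_add (fun u => LQ.ev kapLit u * expq q u) (bQ : ℝ) (bQ : ℝ)
  rw [← h, smul_eq_mul, mul_assoc, ← intervalIntegral.integral_const_mul (Real.exp ((q : ℝ) * (107 / 400)))]
  congr 1
  refine intervalIntegral.integral_congr fun s _ => ?_
  simp only [ev_khatQ, expq]
  rw [show (bQ : ℝ) + bQ * s = bQ * s + bQ by ring,
    show (q : ℝ) * ((bQ : ℝ) * s + bQ) / 2 = (q : ℝ) * (107 / 400) + (q : ℝ) * 107 / 400 * s by
      rw [bQ]; push_cast; ring, Real.exp_add]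
  ring

/-- Taylor remainder of the real exponential: `|e^y − Σ_{j<130} y^j/j!| ≤ 2|y|^{130}/130!` for `|y| ≤ 65`. [folklore] -/
theorem abs_exp_sub_taylor_le {y : ℝ} (hy : |y| ≤ 65) :
    |Real.exp y - ∑ j ∈ range M4, y ^ j / (j.factorial : ℝ)| ≤ 2 * |y| ^ M4 / (M4.factorial : ℝ) := by
  have hc : ‖(y : ℂ)‖ / ((M4 : ℕ).succ : ℕ) ≤ 1 / 2 := by
    rw [Complex.norm_real, Real.norm_eq_abs, M4, div_le_iff₀ (by positivity)]; norm_num; linarith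
  have h := Complex.exp_bound' (x := (y : ℂ)) (n := M4) hc
  have e : ((Real.exp y - ∑ j ∈ range M4, y ^ j / (j.factorial : ℝ) : ℝ) : ℂ)
      = Complex.exp (y : ℂ) - ∑ j ∈ range M4, (y : ℂ) ^ j / (j.factorial : ℂ) := by
    simp [Complex.ofReal_exp]
  rw [← Real.norm_eq_abs, ← Complex.norm_real, e]
  refine h.trans (le_of_eq ?_)
  rw [Complex.norm_real, Real.norm_eq_abs]; ring

/-- `khatQ` has at most `41` coefficients and `Σ|κ̂_i|·S ≤ ahatZ` (kernel checks). [folklore] -/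
theorem khat_checks : khatQ.length ≤ 41 ∧ LQ.absBound khatQ 1 * (S4 : ℚ) ≤ ahatZ := by
  have h : (decide (khatQ.length ≤ 41) && decide (LQ.absBound khatQ 1 * (S4 : ℚ) ≤ ahatZ)) = true := by
    decide +kernel
  simpa using h

/-- `|κ̂(s)| ≤ Â := absBound khatQ 1` on `[−1, 1]`. [folklore] -/
theorem abs_khat_le {s : ℝ} (hs : |s| ≤ 1) : |LQ.ev khatQ s| ≤ (LQ.absBound khatQ 1 : ℝ) :=
  LQ.abs_ev_le_absBound khatQ (by exact_mod_cast hs)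

/-- **Taylor step for `J`**: on `[a₁, a₂] ⊆ [−1, 1]`, `|x| ≤ 65`,
`|∫ κ̂ e^{xs} − Σ_{j<130} x^j/j! ∫ s^j κ̂| ≤ (a₂ − a₁)·Â·2|x|^{130}/130!`. [folklore] -/
theorem abs_J_sub_taylor_le {a₁ a₂ x : ℝ} (h₁ : -1 ≤ a₁) (h₁₂ : a₁ ≤ a₂) (h₂ : a₂ ≤ 1) (hx : |x| ≤ 65) :
    |(∫ s in a₁..a₂, LQ.ev khatQ s * Real.exp (x * s))
        - ∑ j ∈ range M4, x ^ j / (j.factorial : ℝ) * ∫ s in a₁..a₂, s ^ j * LQ.ev khatQ s|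
      ≤ (a₂ - a₁) * ((LQ.absBound khatQ 1 : ℝ) * (2 * |x| ^ M4 / (M4.factorial : ℝ))) := by
  have hc : Continuous fun s => LQ.ev khatQ s := LQ.continuous_ev _
  have hsum : ∑ j ∈ range M4, x ^ j / (j.factorial : ℝ) * ∫ s in a₁..a₂, s ^ j * LQ.ev khatQ s
      = ∫ s in a₁..a₂, LQ.ev khatQ s * ∑ j ∈ range M4, (x * s) ^ j / (j.factorial : ℝ) := by
    have e : ∀ j ∈ range M4, x ^ j / (j.factorial : ℝ) * ∫ s in a₁..a₂, s ^ j * LQ.ev khatQ s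
        = ∫ s in a₁..a₂, LQ.ev khatQ s * ((x * s) ^ j / (j.factorial : ℝ)) := fun j _ => by
      rw [← intervalIntegral.integral_const_mul]
      exact intervalIntegral.integral_congr fun s _ => by rw [mul_pow]; ring
    rw [Finset.sum_congr rfl e, ← intervalIntegral.integral_finsetSum]
    · exact intervalIntegral.integral_congr fun s _ => by rw [Finset.mul_sum]
    · intro j _
      exact (hc.mul ((continuous_const.mul continuous_id).pow j |>.div_const _)).intervalIntegrable _ _
  have i1 : IntervalIntegrable (fun s => LQ.ev khatQ s * Real.exp (x * s)) volume a₁ a₂ :=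
    (hc.mul (Real.continuous_exp.comp (continuous_const.mul continuous_id))).intervalIntegrable _ _
  have i2 : IntervalIntegrable (fun s => LQ.ev khatQ s * ∑ j ∈ range M4, (x * s) ^ j / (j.factorial : ℝ))
      volume a₁ a₂ :=
    (hc.mul (continuous_finsetSum _ fun j _ =>
      (continuous_const.mul continuous_id).pow j |>.div_const _)).intervalIntegrable _ _
  rw [hsum, ← intervalIntegral.integral_sub i1 i2]
  have hpt : ∀ s ∈ Set.uIoc a₁ a₂, ‖LQ.ev khatQ s * Real.exp (x * s)
      - LQ.ev khatQ s * ∑ j ∈ range M4, (x * s) ^ j / (j.factorial : ℝ)‖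
      ≤ (LQ.absBound khatQ 1 : ℝ) * (2 * |x| ^ M4 / (M4.factorial : ℝ)) := by
    intro s hs
    rw [Set.uIoc_of_le h₁₂] at hs
    have hs1 : |s| ≤ 1 := abs_le.2 ⟨by linarith [hs.1], by linarith [hs.2]⟩
    have hxs : |x * s| ≤ |x| := by rw [abs_mul]; exact mul_le_of_le_one_right (abs_nonneg _) hs1
    rw [← mul_sub, norm_mul, Real.norm_eq_abs, Real.norm_eq_abs]
    refine mul_le_mul (abs_khat_le hs1) ((abs_exp_sub_taylor_le (hxs.trans hx)).trans ?_) (abs_nonneg _)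
      (by exact_mod_cast LQ.absBound_nonneg khatQ zero_le_one)
    gcongr
  have h := intervalIntegral.norm_integral_le_of_norm_le_const hpt
  rw [Real.norm_eq_abs, abs_of_nonneg (by linarith : (0 : ℝ) ≤ a₂ - a₁)] at h
  linarith [h]

/-- **`J ∈ JI`**: the exponential moment over `[b a₁ + b, b a₂ + b]` lies in the kernel enclosure built from a moment
table for `[a₁, a₂]`. [folklore] -/
theorem mem_JI {c : MI × MI × MI} (hc : constsOpt = some c) {q : ℤ} (hq : q.natAbs ≤ 69) {a₁ a₂ : ℝ}
    (h₁ : -1 ≤ a₁) (h₁₂ : a₁ ≤ a₂) (h₂ : a₂ ≤ 1) {moms : List MI} (hlen : moms.length = M4)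
    (hmom : ∀ j < M4, MI.mem S4 (∫ s in a₁..a₂, s ^ j * LQ.ev khatQ s) (moms.getD j zI)) :
    MI.mem S4 (∫ u in ((bQ : ℝ) * a₁ + bQ)..((bQ : ℝ) * a₂ + bQ), LQ.ev kapLit u * expq q u)
      (JI c.2.1 c.2.2 q moms) := by
  obtain ⟨-, he, he'⟩ := consts_mem hc
  set x : ℝ := (q : ℝ) * 107 / 400 with hxdef
  have hxq : (q : ℝ) * (107 / 400) = x := by rw [hxdef]; ring
  have hxabs : |x| = |(q : ℝ)| * 107 / 400 := by
    rw [hxdef, abs_div, abs_mul]; norm_num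
  have hq' : |(q : ℝ)| ≤ 69 := by
    rw [← Int.cast_abs, Int.abs_eq_natAbs]; exact_mod_cast hq
  have hx65 : |x| ≤ 65 := by rw [hxabs]; nlinarith [abs_nonneg (q : ℝ)]
  -- the main term
  have hE := mem_epow he he' q
  rw [hxq] at hE
  have hT : MI.mem S4 (taylorR x (fun j => ∫ s in a₁..a₂, s ^ j * LQ.ev khatQ s) M4 0) (taylorI q moms 0) := by
    rw [← hlen]; exact mem_taylorI q moms 0 (fun i hi => by rw [zero_add]; exact hmom i (hlen ▸ hi))
  have hmain := MI.mem_divNat (MI.mem_mulInt (MI.mem_mul S4_pos hE hT) 107) (n := 200) (by norm_num)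
  -- the remainder
  rw [JI]
  refine MI.mem_widen hmain ?_
  rw [J_subst, hxq, taylorR_zero]
  set T : ℝ := ∑ j ∈ range M4, x ^ j / (j.factorial : ℝ) * ∫ s in a₁..a₂, s ^ j * LQ.ev khatQ s with hTdef
  set V : ℝ := ∫ s in a₁..a₂, LQ.ev khatQ s * Real.exp (x * s) with hVdef
  have hrem := abs_J_sub_taylor_le h₁ h₁₂ h₂ hx65
  have hS : (0 : ℝ) < S4 := by exact_mod_cast S4_pos
  have hb : (bQ : ℝ) = 107 / 200 := by rw [bQ]; push_cast; ring
  have hex : Real.exp x ≤ ((epow c.2.1 c.2.2 q).hi : ℝ) / S4 := MI.le_hi_div S4_pos hE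
  have hex0 : 0 < Real.exp x := Real.exp_pos x
  have hA : (LQ.absBound khatQ 1 : ℝ) ≤ (ahatZ : ℝ) / S4 := by
    rw [le_div_iff₀ hS]; exact_mod_cast khat_checks.2
  have hA0 : (0 : ℝ) ≤ LQ.absBound khatQ 1 := by exact_mod_cast LQ.absBound_nonneg khatQ zero_le_one
  have hdiff : |(bQ : ℝ) * Real.exp x * V - Real.exp x * T * ((107 : ℤ) : ℝ) / ((200 : ℕ) : ℝ)|
      = (bQ : ℝ) * Real.exp x * |V - T| := by
    rw [show (bQ : ℝ) * Real.exp x * V - Real.exp x * T * ((107 : ℤ) : ℝ) / ((200 : ℕ) : ℝ)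
      = (bQ : ℝ) * Real.exp x * (V - T) by rw [hb]; push_cast; ring, abs_mul, abs_mul,
      abs_of_pos (by rw [hb]; norm_num), abs_of_pos hex0]
  rw [hdiff]
  have hR0 : (0 : ℝ) ≤ 2 * |x| ^ M4 / (M4.factorial : ℝ) := by positivity
  have h2 : |V - T| ≤ 2 * (((ahatZ : ℝ) / S4) * (2 * |x| ^ M4 / (M4.factorial : ℝ))) :=
    hrem.trans (mul_le_mul (by linarith) (mul_le_mul_of_nonneg_right hA hR0) (mul_nonneg hA0 hR0) (by norm_num))
  have hEhi : (0 : ℝ) ≤ ((epow c.2.1 c.2.2 q).hi : ℝ) / S4 := hex0.le.trans hex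
  have step1 : (bQ : ℝ) * Real.exp x * |V - T| * S4
      ≤ (107 / 200) * (((epow c.2.1 c.2.2 q).hi : ℝ) / S4)
          * (2 * (((ahatZ : ℝ) / S4) * (2 * |x| ^ M4 / (M4.factorial : ℝ)))) * S4 := by
    rw [hb]
    refine mul_le_mul_of_nonneg_right ?_ hS.le
    exact mul_le_mul (mul_le_mul_of_nonneg_left hex (by norm_num)) h2 (abs_nonneg _)
      (mul_nonneg (by norm_num) hEhi)
  refine step1.trans ?_
  rw [remZ]
  have hden : (0 : ℤ) < (200 * ((400 ^ M4 * M4.factorial : ℕ) : ℤ)) * (S4 : ℤ) :=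
    mul_pos (mul_pos (by norm_num) (Int.natCast_pos.2 (by positivity))) (Int.natCast_pos.2 S4_pos)
  refine le_trans (le_of_eq ?_) (Numerics.div_le_cdiv hden)
  rw [hxabs, div_pow]
  have hS' : (S4 : ℝ) ≠ 0 := hS.ne'
  have h4 : (400 : ℝ) ^ M4 ≠ 0 := by positivity
  push_cast
  field_simp
  ring

/-! ## `Comb ∈ combI` -/

/-- `(List.range n).map f` at index `k < n`. [folklore] -/
theorem getD_map_range_MI (f : ℕ → MI) {n k : ℕ} (hk : k < n) : ((List.range n).map f).getD k zI = f k := by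
  rw [List.getD_eq_getElem?_getD, List.getElem?_map, List.getElem?_range hk]; rfl

/-- `zipWith MI.sub` at an index inside both lists. [folklore] -/
theorem getD_zipWith_sub {F L : List MI} {j : ℕ} (hF : j < F.length) (hL : j < L.length) :
    (List.zipWith MI.sub F L).getD j zI = MI.sub (F.getD j zI) (L.getD j zI) := by
  simp [List.getD_eq_getElem?_getD, List.getElem?_zipWith, List.getElem?_eq_getElem hF, List.getElem?_eq_getElem hL]

/-- `s_L = log 2/b − 1 ∈ [−1, 1]` and `b s_L + b = log 2`. [folklore] -/
theorem sL_facts : -1 ≤ Real.log 2 / bQ - 1 ∧ Real.log 2 / bQ - 1 ≤ 1 ∧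
    (bQ : ℝ) * (Real.log 2 / bQ - 1) + bQ = Real.log 2 := by
  have hb : (0 : ℝ) < bQ := by rw [bQ]; norm_num
  have hl0 : 0 < Real.log 2 := Real.log_pos (by norm_num)
  have hl1 : Real.log 2 ≤ 2 * bQ := by rw [bQ]; have := Real.log_two_lt_d9; push_cast; linarith
  refine ⟨by have := div_pos hl0 hb; linarith, ?_, by field_simp; ring⟩
  have : Real.log 2 / bQ ≤ 2 := by rw [div_le_iff₀ hb]; linarith
  linarith

/-- **`Comb(q/2) ∈ combI c q`** for `|q| ≤ 69`. [folklore] -/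
theorem mem_combI {c : MI × MI × MI} (hc : constsOpt = some c) {q : ℤ} (hq : q.natAbs ≤ 69) :
    MI.mem S4 (combR q) (combI c q) := by
  obtain ⟨hl, -, -⟩ := consts_mem hc
  obtain ⟨hs1, hs2, hsL⟩ := sL_facts
  set sL : ℝ := Real.log 2 / bQ - 1 with hsLdef
  have hkc : Continuous fun s => LQ.ev khatQ s := LQ.continuous_ev _
  have hI : ∀ (j : ℕ) (u v : ℝ), IntervalIntegrable (fun s => s ^ j * LQ.ev khatQ s) volume u v := fun j u v =>
    ((continuous_pow j).mul hkc).intervalIntegrable _ _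
  -- the three moment tables
  have hF : ∀ j < M4, MI.mem S4 (∫ s in (-1 : ℝ)..1, s ^ j * LQ.ev khatQ s) (momsF.getD j zI) := fun j hj => by
    rw [momsF, getD_map_range_MI _ hj]; exact mem_momI lmem_khatI j
  have hsLI : MI.mem S4 sL (sLI c.1) := by
    have h := MI.mem_sub (MI.mem_divNat (MI.mem_mulInt hl 200) (n := 107) (by norm_num)) (MI.mem_ofInt S4 1)
    rw [sLI, hsLdef, show Real.log 2 / (bQ : ℝ) - 1 = Real.log 2 * ((200 : ℤ) : ℝ) / ((107 : ℕ) : ℝ) - ((1 : ℤ) : ℝ) by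
      rw [bQ]; push_cast; ring]
    exact h
  have hL : ∀ j < M4, MI.mem S4 (∫ s in (-1 : ℝ)..sL, s ^ j * LQ.ev khatQ s) ((momsL c.1).getD j zI) := by
    intro j hj
    rw [momsL, getD_map_range_MI _ hj]
    refine mem_momGI (N := M4 + 41) (fun i hi => ?_) lmem_khatI j (by have := khat_checks.1; omega)
    have h := mem_powList hsLI (M4 + 42) (MI.mem_ofInt S4 1) i (by omega)
    simpa using h
  have hlenF : momsF.length = M4 := by simp [momsF]
  have hlenL : (momsL c.1).length = M4 := by simp [momsL]
  have hR : ∀ j < M4, MI.mem S4 (∫ s in sL..1, s ^ j * LQ.ev khatQ s) ((momsR c.1).getD j zI) := by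
    intro j hj
    rw [momsR, getD_zipWith_sub (hlenF ▸ hj) (hlenL ▸ hj),
      ← intervalIntegral.integral_interval_sub_left (hI j (-1) 1) (hI j (-1) sL)]
    exact MI.mem_sub (hF j hj) (hL j hj)
  have hlenR : (momsR c.1).length = M4 := by simp [momsR, List.length_zipWith, hlenF, hlenL]
  -- the three `J`'s
  have hq' : (-q).natAbs ≤ 69 := by simpa using hq
  have hJ0 := mem_JI hc hq (a₁ := -1) (a₂ := 1) (by norm_num) (by norm_num) le_rfl hlenF hF
  rw [show (bQ : ℝ) * (-1) + bQ = 0 by ring, show (bQ : ℝ) * 1 + bQ = 2 * bQ by ring] at hJ0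
  have hJL := mem_JI hc hq' (a₁ := -1) (a₂ := sL) le_rfl hs1 hs2 hlenL hL
  rw [show (bQ : ℝ) * (-1) + bQ = 0 by ring, hsL] at hJL
  have hJR := mem_JI hc hq (a₁ := sL) (a₂ := 1) hs1 hs2 le_rfl hlenR hR
  rw [hsL, show (bQ : ℝ) * 1 + bQ = 2 * bQ by ring] at hJR
  rw [combR, combI]
  exact MI.mem_sub (MI.mem_sub (mem_mulFracI' hJ0 _) (mem_mulFracI' hJL _)) (mem_mulFracI' hJR _)

/-! ## The table, `B ∈ bsumI`, and the bound -/

/-- Index bookkeeping (kernel): the `q`'s of `termK` are in `qNeg`, those of the non-zero `termKN` are in `qPos`,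
and all of them have `|q| ≤ 69`. [folklore] -/
theorem idx_checks : (∀ k : ℕ, k < 35 → (-(2 * (k : ℤ) + 1)) ∈ qNeg) ∧
    (∀ k : ℕ, k < 35 → ∀ n : ℕ, n < 75 → (pkList k).getD n 0 = 0 ∨ (2 * ((n : ℤ) - k) - 1) ∈ qPos) ∧
    (∀ q ∈ qNeg, q.natAbs ≤ 69) ∧ (∀ q ∈ qPos, q.natAbs ≤ 69) := by
  refine ⟨by decide +kernel, by decide +kernel, by decide +kernel, by decide +kernel⟩

/-- **`Comb(q/2) ∈ combT q`** for every `q` of the table. [folklore] -/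
theorem mem_combT {q : ℤ} (h : q ∈ qNeg ∨ q ∈ qPos) : MI.mem S4 (combR q) (combT q) := by
  obtain ⟨c, hc⟩ := constsOpt_isSome
  rcases h with h | h
  · exact mem_combT_of_check hc combCheck_neg h (mem_combI hc (idx_checks.2.2.1 q h))
  · exact mem_combT_of_check hc combCheck_pos h (mem_combI hc (idx_checks.2.2.2 q h))

/-- **`Breal ∈ bsumI`**. [folklore] -/
theorem mem_bsumI : MI.mem S4 Breal bsumI := by
  rw [Breal, Bform, bsumI]
  refine mem_sumI_range 35 fun k hk => ?_
  rw [termK]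
  refine MI.mem_add (mem_mulFracI' (mem_combT (Or.inl (idx_checks.1 k hk))) _) ?_
  refine mem_sumI_range 75 fun n hn => ?_
  by_cases h0 : (pkList k).getD n 0 = 0
  · simp only [termKN, h0, mul_zero, Rat.cast_zero, zero_mul, if_true]
    exact mem_zI
  · simp only [termKN, if_neg h0]
    rcases idx_checks.2.1 k hk n hn with h | h
    · exact absurd h h0
    · exact mem_mulFracI' (mem_combT (Or.inr h)) _

/-- **`BloQ ≤ Breal`** (`checkB_eq_true`: `BloQ·2^192 ≤ bsumI.lo`). [folklore] -/
theorem BloQ_le_Breal : ((BloQ : ℚ) : ℝ) ≤ Breal := by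
  have h := checkB_eq_true
  simp only [checkB, Bool.and_eq_true, decide_eq_true_eq] at h
  obtain ⟨⟨h1, -⟩, -⟩ := h
  have hm := mem_bsumI
  rw [MI.mem_def] at hm
  have hS : (0 : ℝ) < S4 := by exact_mod_cast S4_pos
  have h1' : ((BloQ.num : ℤ) : ℝ) * (S4 : ℝ) ≤ (BloQ.den : ℝ) * (bsumI.lo : ℝ) := by exact_mod_cast h1
  have hden : (0 : ℝ) < BloQ.den := by exact_mod_cast BloQ.pos
  rw [Rat.cast_def, div_le_iff₀ hden]
  have h2 : (BloQ.den : ℝ) * (bsumI.lo : ℝ) ≤ BloQ.den * (Breal * S4) := mul_le_mul_of_nonneg_left hm.1 hden.le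
  have h3 : ((BloQ.num : ℤ) : ℝ) * S4 ≤ (Breal * BloQ.den) * S4 := by nlinarith
  exact le_of_mul_le_mul_right h3 hS

/-- **THE `B`-BOUND OF THE CERTIFICATE** (hypothesis `hB` of cc-s2-1's bridge with `B = BloQ = 51/10⁴`):
`BloQ ≤ Re ⟨η | ϑ(T₂ (G ⋆ G̃)) η⟩` for `G = polyWitness gL bQ`, `η = eta`. [folklore] -/
theorem BloQ_le_re_soninTraceForm :
    ((BloQ : ℚ) : ℝ) ≤ (soninTraceForm (twistKernel 2 (weilConv (polyWitness gL bQ) (weilReflect (polyWitness gL bQ))))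
      (eta : ℝ → ℂ)).re := by
  rw [re_soninTraceForm_eq_Breal]; exact BloQ_le_Breal

end Summit.RiemannHypothesis.RiemannHypothesis.SoninCert
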